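import Summits.CriticalPhenomena.PercolationContinuityZ3.Theses.PercNearOneGluing
import Literature.Probability.Percolation.PercolationEvents
import HarnessLib.Audit
import Summits.CriticalPhenomena.PercolationContinuityZ3.Theorems.PercNearOneGluingAdditiveGluingKnLemma3ii
import Summits.CriticalPhenomena.PercolationContinuityZ3.Theorems.PercNearOneGluingAdditiveGluingKnLemma2
import Summits.CriticalPhenomena.PercolationContinuityZ3.Theorems.PercNearOneGluingAdditiveGluingGoodStepOneBond
import Summits.CriticalPhenomena.PercolationContinuityZ3.Theorems.PercNearOneGluingAdditiveGluingGlueReach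

/-! TTRL-lite variant V2408 of stmt-CriticalPhenomena-4574

(`stub_shorteningStep` of line `kn_shortening_induction` = Kozma–Nitzan Conjecture 6 with the
induction hypothesis displayed; move `strengthen_hyp`: assume `x ∈ A`, i.e. the second endpoint of
the shortened pair is itself a relay).

Write `μ = prodBernoulli w`, `μ'' = prodBernoulli (w[s(v,x) ↦ 1])` and `e = s(v, x)`.

* Since `μ''` is a probability measure, `μ''(v ↔ A) · μ''(a₀ ↔ b) ≤ μ''(a₀ ↔ b)`, so it suffices
  to show `μ''(a₀ ↔ b) ≤ μ''(v ↔ b)`.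
* Opening one pair (`goodStep_real_update_one`): `μ''(S) = μ {ω | ω ∪ {e} ∈ S}`.
* Glued reachability (`glueReach_walk_split`): if `a₀ ↔ b` in `ω ∪ {e}` then in `ω` either
  `a₀ ↔ b`, or `a₀ ↮ b` and (`a₀ ↔ v` or `a₀ ↔ x`) and (`v ↔ b` or `x ↔ b`) (event `R`);
  conversely `{x ↔ b} ∪ {v ↔ b} ⊆ {ω | ω ∪ {e} ∈ {v ↔ b}}`.
* The minimiser hypothesis at the relay `x ∈ A` gives `μ(a₀ ↔ b) ≤ μ(x ↔ b)`, and Kozma–Nitzan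
  Lemma 3(ii) (`stub_knLemma3ii`, from the BHK conditional association inequalities) with the
  DECREASING event `Q = {a₀ ↮ v}` determined by the cluster of `a₀` upgrades it to
  `μ({a₀ ↔ b} ∩ Q) ≤ μ({x ↔ b} ∩ Q)`.
* Hence `μ''(a₀ ↔ b) ≤ μ(a₀ ↔ b) + μ(R) = μ({a₀↔b} ∩ Q) + μ({a₀↔b} ∖ Q) + μ(R)
  ≤ μ({x↔b} ∩ Q) + μ({a₀↔b} ∖ Q) + μ(R)`, and the three events `{x ↔ b, a₀ ↮ v}`,
  `{a₀ ↔ b, a₀ ↔ v}`, `R` are pairwise disjoint and all contained in `{ω | ω ∪ {e} ∈ {v ↔ b}}`,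
  so the right-hand side is at most `μ''(v ↔ b)`.

The induction hypothesis, `v ∉ A` and `w s(v,x) = 0` are not used.  No new definitions, no named
facts. -/

namespace Summit.CriticalPhenomena.PercolationContinuityZ3.Theorems

open MeasureTheory Set Literature.Probability.LatticeModels Literature.Probability.Percolation
open scoped Classical BigOperators

/-- TTRL-lite variant V2408 of `stub_shorteningStep` (stmt-CriticalPhenomena-4574, Kozma–Nitzan
Conjecture 6 with induction hypothesis) under the extra hypothesis `x ∈ A`: then
`μ''(v ↔ A) ≤ 1` and `μ''(a₀ ↔ b) ≤ μ''(v ↔ b)` for `μ'' = prodBernoulli (w[s(v,x) ↦ 1])`, the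
latter by the one-pair opening formula, glued reachability, and Kozma–Nitzan Lemma 3(ii) applied to
`μ(a₀ ↔ b) ≤ μ(x ↔ b)` with the decreasing cluster event `{a₀ ↮ v}`. -/
theorem stub_shorteningStep_var2408 : ∀ (n : ℕ) (w : Sym2 (Fin n) → unitInterval) (A : Finset (Fin n)) (b v x a₀ : Fin n), x ∈ A → v ∉ A → v ≠ x → w s(v, x) = 0 → a₀ ∈ A → (∀ a ∈ A, (prodBernoulli w).real (openConn a₀ b) ≤ (prodBernoulli w).real (openConn a b)) → (∀ w' : Sym2 (Fin n) → unitInterval, (∀ e, w e = 0 → w' e = 0) → ∀ (A' : Finset (Fin n)) (o' b' : Fin n) (t : ℝ), (∀ a ∈ A', t ≤ (prodBernoulli w').real (openConn a b')) → (prodBernoulli w').real (⋃ a ∈ A', openConn o' a) * t ≤ (prodBernoulli w').real (openConn o' b')) → (prodBernoulli (Function.update w s(v, x) 1)).real (⋃ a ∈ A, openConn v a) * (prodBernoulli (Function.update w s(v, x) 1)).real (openConn a₀ b) ≤ (prodBernoulli (Function.update w s(v, x) 1)).real (openConn v b) := by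
  intro n w A b v x a₀ hxA _hvA hvx _hw0 _ha₀ hmin _hIH
  -- the decreasing event `Q = {a₀ ↮ v}` and the exchange event `R`
  set Q : Set (BondConfig (Fin n)) := (openConn a₀ v)ᶜ with hQdef
  set R : Set (BondConfig (Fin n)) :=
    (openConn a₀ b)ᶜ ∩ ((openConn a₀ v ∪ openConn a₀ x) ∩ (openConn v b ∪ openConn x b)) with hRdef
  have hQm : MeasurableSet Q := MeasurableSet.of_discrete
  have hF2m : MeasurableSet (openConn a₀ b \ Q : Set (BondConfig (Fin n))) :=
    MeasurableSet.of_discrete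
  have hRm : MeasurableSet R := MeasurableSet.of_discrete
  -- (1) glued reachability: `{ω | ω ∪ {e} ∈ {a₀ ↔ b}} ⊆ {a₀ ↔ b} ∪ R`
  have hc1 : {ω : BondConfig (Fin n) | ω ∪ {s(v, x)} ∈ openConn a₀ b} ⊆ openConn a₀ b ∪ R := by
    intro ω hω
    have hω' : (openGraph (ω ∪ {s(v, x)})).Reachable a₀ b := hω
    have hHG : ∀ p q : Fin n, (openGraph (ω ∪ {s(v, x)})).Adj p q →
        (openGraph ω).Adj p q ∨ (p ∈ ({v, x} : Finset (Fin n)) ∧ q ∈ ({v, x} : Finset (Fin n))) := by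
      intro p q hpq
      rw [openGraph_adj] at hpq
      obtain ⟨hmem | hmem, hne⟩ := hpq
      · exact Or.inl ((openGraph_adj ω p q).2 ⟨hmem, hne⟩)
      · rcases Sym2.eq_iff.1 (Set.mem_singleton_iff.1 hmem) with ⟨hp, hq⟩ | ⟨hp, hq⟩
        · exact Or.inr ⟨by simp [hp], by simp [hq]⟩
        · exact Or.inr ⟨by simp [hp], by simp [hq]⟩
    obtain ⟨wk⟩ := hω'
    rcases glueReach_walk_split hHG wk with h | ⟨⟨s, hs, h1⟩, ⟨s', hs', h2⟩⟩
    · exact Or.inl h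
    · by_cases hab : ω ∈ openConn a₀ b
      · exact Or.inl hab
      · refine Or.inr ⟨hab, ?_, ?_⟩
        · simp only [Finset.mem_insert, Finset.mem_singleton] at hs
          rcases hs with rfl | rfl
          · exact Or.inl h1
          · exact Or.inr h1
        · simp only [Finset.mem_insert, Finset.mem_singleton] at hs'
          rcases hs' with rfl | rfl
          · exact Or.inl h2
          · exact Or.inr h2
  -- (2) the events `{x ↔ b}`, `{v ↔ b}` force `v ↔ b` after opening `e`
  have hGH : ∀ ω : BondConfig (Fin n), openGraph ω ≤ openGraph (ω ∪ {s(v, x)}) := by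
    intro ω p q hpq
    rw [openGraph_adj] at hpq ⊢
    exact ⟨Or.inl hpq.1, hpq.2⟩
  have hvxAdj : ∀ ω : BondConfig (Fin n), (openGraph (ω ∪ {s(v, x)})).Adj v x := by
    intro ω
    rw [openGraph_adj]
    exact ⟨Or.inr rfl, hvx⟩
  have hxbT : (openConn x b : Set (BondConfig (Fin n))) ⊆
      {ω : BondConfig (Fin n) | ω ∪ {s(v, x)} ∈ openConn v b} := fun ω hω =>
    (hvxAdj ω).reachable.trans (SimpleGraph.Reachable.mono (hGH ω) hω)
  have hvbT : (openConn v b : Set (BondConfig (Fin n))) ⊆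
      {ω : BondConfig (Fin n) | ω ∪ {s(v, x)} ∈ openConn v b} := fun ω hω =>
    SimpleGraph.Reachable.mono (hGH ω) hω
  have hc2 : (openConn x b ∩ Q) ∪ (openConn a₀ b \ Q) ∪ R ⊆
      {ω : BondConfig (Fin n) | ω ∪ {s(v, x)} ∈ openConn v b} := by
    rintro ω ((⟨hxb, -⟩ | ⟨hab, hnQ⟩) | ⟨-, -, hvb | hxb⟩)
    · exact hxbT hxb
    · have hav : ω ∈ openConn a₀ v := by
        by_contra h
        exact hnQ h
      exact hvbT (SimpleGraph.Reachable.trans (SimpleGraph.Reachable.symm hav) hab)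
    · exact hvbT hvb
    · exact hxbT hxb
  -- (3) disjointness
  have hc3 : Disjoint (openConn x b ∩ Q) (openConn a₀ b \ Q) := by
    rw [Set.disjoint_left]
    rintro ω ⟨-, hQ⟩ ⟨-, hnQ⟩
    exact hnQ hQ
  have hc4 : Disjoint ((openConn x b ∩ Q) ∪ (openConn a₀ b \ Q)) R := by
    rw [Set.disjoint_left]
    rintro ω (⟨hxb, hQ⟩ | ⟨hab, -⟩) ⟨hnab, hl, -⟩
    · rcases hl with hav | hax
      · exact hQ hav
      · exact hnab (SimpleGraph.Reachable.trans hax hxb)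
    · exact hnab hab
  -- (4) Kozma–Nitzan Lemma 3(ii) with the decreasing cluster event `Q = {a₀ ↮ v}`
  have hc5 : (prodBernoulli w).real (openConn a₀ b ∩ Q) ≤ (prodBernoulli w).real (openConn x b ∩ Q) := by
    have hdet : ∀ ω ω' : BondConfig (Fin n), ω' ∈ Q →
        openEdgeCluster ω a₀ ⊆ openEdgeCluster ω' a₀ → ω ∈ Q := by
      intro ω ω' hω' hsub hω
      exact hω' (reachable_openGraph_of_fromEdgeSet ω' (openEdgeCluster_subset ω' a₀)
        (reachable_fromEdgeSet_of_openEdgeCluster_subset ω hsub hω))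
    have h := stub_knLemma3ii n w a₀ x b Q 0 hdet le_rfl
      (by rw [add_zero]; exact hmin x hxA)
    rw [add_zero] at h
    exact h
  -- (5) reduce to `μ''(a₀ ↔ b) ≤ μ''(v ↔ b)` and chain
  have hmain : (prodBernoulli (Function.update w s(v, x) 1)).real (openConn a₀ b) ≤
      (prodBernoulli (Function.update w s(v, x) 1)).real (openConn v b) := by
    rw [goodStep_real_update_one w hvx (openConn a₀ b), goodStep_real_update_one w hvx (openConn v b)]
    calc (prodBernoulli w).real {ω : BondConfig (Fin n) | ω ∪ {s(v, x)} ∈ openConn a₀ b}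
        ≤ (prodBernoulli w).real (openConn a₀ b ∪ R) := measureReal_mono hc1
      _ ≤ (prodBernoulli w).real (openConn a₀ b) + (prodBernoulli w).real R :=
          measureReal_union_le _ _
      _ = (prodBernoulli w).real (openConn a₀ b ∩ Q) + (prodBernoulli w).real (openConn a₀ b \ Q) +
            (prodBernoulli w).real R := by
          rw [measureReal_inter_add_sdiff hQm]
      _ ≤ (prodBernoulli w).real (openConn x b ∩ Q) + (prodBernoulli w).real (openConn a₀ b \ Q) +
            (prodBernoulli w).real R := by
          gcongr
      _ = (prodBernoulli w).real ((openConn x b ∩ Q) ∪ (openConn a₀ b \ Q)) +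
            (prodBernoulli w).real R := by
          rw [measureReal_union hc3 hF2m]
      _ = (prodBernoulli w).real ((openConn x b ∩ Q) ∪ (openConn a₀ b \ Q) ∪ R) := by
          rw [measureReal_union hc4 hRm]
      _ ≤ (prodBernoulli w).real {ω : BondConfig (Fin n) | ω ∪ {s(v, x)} ∈ openConn v b} :=
          measureReal_mono hc2
  have hU1 : (prodBernoulli (Function.update w s(v, x) 1)).real (⋃ a ∈ A, openConn v a) ≤ 1 :=
    measureReal_le_one
  calc (prodBernoulli (Function.update w s(v, x) 1)).real (⋃ a ∈ A, openConn v a) *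
        (prodBernoulli (Function.update w s(v, x) 1)).real (openConn a₀ b)
      ≤ 1 * (prodBernoulli (Function.update w s(v, x) 1)).real (openConn a₀ b) :=
        mul_le_mul_of_nonneg_right hU1 measureReal_nonneg
    _ = (prodBernoulli (Function.update w s(v, x) 1)).real (openConn a₀ b) := one_mul _
    _ ≤ (prodBernoulli (Function.update w s(v, x) 1)).real (openConn v b) := hmain

end Summit.CriticalPhenomena.PercolationContinuityZ3.Theorems
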